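import Summits.Ventures.HSemireg.HomComplex
import Mathlib.Algebra.Homology.HomologicalComplexAbelian
import Mathlib.Algebra.Homology.HomologySequenceLemmas
import HarnessLib

/-!
# Venture HSemireg — the internal Hom complex, II: functoriality in `E•`, short exactness, and the
# induction step for quasi-isomorphisms

HONEST FRAMING. Kernel plumbing for the cell `pub-hsemireg` (sequel to `HomComplex.lean`; a re-usable
carrier lemma, NOT a «K2 result»): constructions and proved lemmas on real carriers; no hypothesis
structures, no named facts, no claim about any variety; nothing here bears on HC / HC_CM / HC_AV.

* `quasiIso_τ₂`: two-out-of-three for quasi-isomorphisms, MIDDLE term — for a morphism `φ : S₁ ⟶ S₂` of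
  short exact sequences of homological complexes in an abelian category, `φ.τ₁`, `φ.τ₃` quasi-isos ⟹
  `φ.τ₂` quasi-iso (Mathlib, this pin, has only `HomologySequence.quasiIso_τ₃` and marks `τ₁`, `τ₂` as
  TODO); proof by the four lemmas on the windows `H_{i'}(X₃) → H_i(X₁) → H_i(X₂) → H_i(X₃)` and
  `H_i(X₁) → H_i(X₂) → H_i(X₃) → H_j(X₁)` of the long exact homology sequence.
* `dualComplexMap`, `HomComplex.premap` (`𝓗om•(ψ, F•)`), `ι_premap`, `premap_comp`, `premap_zero`,
  `premap_comp_map` (bifunctoriality).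
* `HomComplex.homShortComplex S F` = `𝓗om•(S.X₃, F) → 𝓗om•(S.X₂, F) → 𝓗om•(S.X₁, F)` for a short
  complex `S` of complexes, its degreewise `Splitting` from a degreewise splitting of `S` (pre-composition
  with the sections / retractions, summand by summand) and hence `homShortComplex_shortExact`.
* `HomComplex.quasiIso_map_of_degreewiseSplit`: the INDUCTION STEP — if `𝓗om•(S.X₃, φ)` and `𝓗om•(S.X₁, φ)`
  are quasi-isomorphisms then so is `𝓗om•(S.X₂, φ)` (for `S` degreewise split).

References: The Stacks project, *More on Algebra*, Section «Hom complexes»; *Homological Algebra*, Sections «Long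
exact sequence of cohomology» and «The five lemma». [StacksProject]
-/

noncomputable section

open CategoryTheory CategoryTheory.Limits AlgebraicGeometry Opposite

universe u

/-! ## §1 Two-out-of-three for quasi-isomorphisms: the middle term -/

namespace Summit.Ventures.HSemireg

section QuasiIsoTau2

open ComposableArrows Abelian HomologicalComplex HomologicalComplex.HomologySequence

variable {C ι : Type*} [Category C] [Abelian C] {c : ComplexShape ι}
  {S₁ S₂ : ShortComplex (HomologicalComplex C c)} (φ : S₁ ⟶ S₂)
  (hS₁ : S₁.ShortExact) (hS₂ : S₂.ShortExact)

include hS₁ hS₂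

/-- Four lemma for `H_i(τ₂)` (mono), on the window `H_{i'}(X₃) → H_i(X₁) → H_i(X₂) → H_i(X₃)`. [folklore] -/
lemma mono_homologyMap_τ₂ (i : ι)
    (h₁ : ∀ i', c.Rel i' i → Epi (homologyMap φ.τ₃ i'))
    (h₂ : Mono (homologyMap φ.τ₁ i)) (h₃ : Mono (homologyMap φ.τ₃ i)) :
    Mono (homologyMap φ.τ₂ i) := by
  by_cases hi : ∃ i', c.Rel i' i
  · obtain ⟨i', hi'⟩ := hi
    apply mono_of_epi_of_mono_of_mono
      ((δ₀Functor ⋙ δ₀Functor).map (mapComposableArrows₅ φ hS₁ hS₂ i' i hi'))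
    · exact (composableArrows₅_exact hS₁ i' i hi').δ₀.δ₀
    · exact (composableArrows₅_exact hS₂ i' i hi').δ₀.δ₀
    · exact h₁ _ hi'
    · exact h₂
    · exact h₃
  · have := hS₂.mono_f
    refine mono_of_mono_of_mono_of_mono (mapComposableArrows₂ φ i) (composableArrows₂_exact hS₁ i) ?_ h₂ h₃
    apply mono_homologyMap_of_mono_of_not_rel
    simpa using hi

/-- Four lemma for `H_i(τ₂)` (epi), on the window `H_i(X₁) → H_i(X₂) → H_i(X₃) → H_j(X₁)`. [folklore] -/
lemma epi_homologyMap_τ₂ (i : ι)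
    (h₁ : Epi (homologyMap φ.τ₁ i)) (h₂ : Epi (homologyMap φ.τ₃ i))
    (h₃ : ∀ j, c.Rel i j → Mono (homologyMap φ.τ₁ j)) :
    Epi (homologyMap φ.τ₂ i) := by
  by_cases hi : ∃ j, c.Rel i j
  · obtain ⟨j, hij⟩ := hi
    apply epi_of_epi_of_epi_of_mono
      ((δlastFunctor ⋙ δlastFunctor).map (mapComposableArrows₅ φ hS₁ hS₂ i j hij))
    · exact (composableArrows₅_exact hS₁ i j hij).δlast.δlast
    · exact (composableArrows₅_exact hS₂ i j hij).δlast.δlast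
    · exact h₁
    · exact h₂
    · exact h₃ _ hij
  · have := hS₁.epi_g
    refine epi_of_epi_of_epi_of_epi (mapComposableArrows₂ φ i) (composableArrows₂_exact hS₂ i) ?_ h₁ h₂
    apply epi_homologyMap_of_epi_of_not_rel
    simpa using hi

/-- **Two out of three for quasi-isomorphisms, middle term**: if `φ : S₁ ⟶ S₂` is a morphism of short exact
sequences of complexes with `φ.τ₁` and `φ.τ₃` quasi-isomorphisms, then `φ.τ₂` is a quasi-isomorphism (completes Mathlib's `HomologySequence.quasiIso_τ₃`). [folklore] -/
lemma quasiIso_τ₂ (h₁ : QuasiIso φ.τ₁) (h₃ : QuasiIso φ.τ₃) : QuasiIso φ.τ₂ := by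
  rw [quasiIso_iff]
  intro i
  rw [quasiIsoAt_iff_isIso_homologyMap]
  have : Mono (homologyMap φ.τ₂ i) :=
    mono_homologyMap_τ₂ φ hS₁ hS₂ i (fun _ _ => inferInstance) inferInstance inferInstance
  have : Epi (homologyMap φ.τ₂ i) :=
    epi_homologyMap_τ₂ φ hS₁ hS₂ i inferInstance inferInstance (fun _ _ => inferInstance)
  apply isIso_of_mono_of_epi

end QuasiIsoTau2

open Literature.AlgebraicGeometry.Modules Literature.AlgebraicGeometry.Motives

variable (X : Scheme.{u})

/-! ## §2 Functoriality of `𝓗om•(E•, F•)` in `E•` -/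

/-- Functoriality of the dual complex: `ψ : E• → E'•` gives `dualComplex E' → dualComplex E`. -/
def dualComplexMap {E E' : CochainComplex X.Modules ℤ} (ψ : E ⟶ E') : dualComplex X E' ⟶ dualComplex X E where
  f i := (ψ.f (-i)).op
  comm' i j _ := by
    change (ψ.f (-i)).op ≫ ((j.negOnePow : ℤˣ) • E.d (-j) (-i)).op =
      ((j.negOnePow : ℤˣ) • E'.d (-j) (-i)).op ≫ (ψ.f (-j)).op
    rw [← op_comp, ← op_comp, Linear.units_smul_comp, Linear.comp_units_smul, ψ.comm]

/-- `dualComplexMap (𝟙 E) = 𝟙`. -/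
@[simp]
lemma dualComplexMap_id (E : CochainComplex X.Modules ℤ) : dualComplexMap X (𝟙 E) = 𝟙 _ := rfl

/-- `dualComplexMap` is contravariantly functorial. -/
lemma dualComplexMap_comp {E E' E'' : CochainComplex X.Modules ℤ} (ψ : E ⟶ E') (ψ' : E' ⟶ E'') :
    dualComplexMap X (ψ ≫ ψ') = dualComplexMap X ψ' ≫ dualComplexMap X ψ := rfl

namespace HomComplex

/-- Contravariant functoriality in `E•`: `𝓗om•(ψ, F•)` for `ψ : E• ⟶ E'•`. -/
abbrev premap {E E' : CochainComplex X.Modules ℤ} (ψ : E ⟶ E') (F : CochainComplex X.Modules ℤ) :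
    homComplex X E' F ⟶ homComplex X E F :=
  HomologicalComplex.mapBifunctorMap (𝟙 F) (dualComplexMap X ψ) (sheafHomBifunctor X).flip (ComplexShape.up ℤ)

/-- On the summand `𝓗om(E'^{-i}, F^q)`, `𝓗om•(ψ, F•)` is pre-composition with `ψ^{-i}`. -/
lemma ι_premap {E E' : CochainComplex X.Modules ℤ} (ψ : E ⟶ E') (F : CochainComplex X.Modules ℤ)
    (q i n : ℤ) (h : q + i = n) :
    ι X E' F q i n h ≫ (premap X ψ F).f n = sheafHomMapLeft (ψ.f (-i)) (F.X q) ≫ ι X E F q i n h := by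
  refine (HomologicalComplex.ι_mapBifunctorMap (𝟙 F) (dualComplexMap X ψ) (sheafHomBifunctor X).flip
    (ComplexShape.up ℤ) q i n h).trans ?_
  rw [HomologicalComplex.id_f, CategoryTheory.Functor.map_id, NatTrans.id_app, Category.id_comp]
  rfl

/-- `𝓗om•(ψ ≫ ψ', F) = 𝓗om•(ψ', F) ≫ 𝓗om•(ψ, F)`. -/
lemma premap_comp {E E' E'' : CochainComplex X.Modules ℤ} (ψ : E ⟶ E') (ψ' : E' ⟶ E'')
    (F : CochainComplex X.Modules ℤ) : premap X (ψ ≫ ψ') F = premap X ψ' F ≫ premap X ψ F := by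
  refine HomologicalComplex.hom_ext _ _ fun n => HomologicalComplex.mapBifunctor.hom_ext fun q i h => ?_
  change ι X E'' F q i n h ≫ _ = ι X E'' F q i n h ≫ _
  rw [HomologicalComplex.comp_f, reassoc_of% (ι_premap X ψ' F q i n h), ι_premap X ψ F q i n h,
    ι_premap X (ψ ≫ ψ') F q i n h, HomologicalComplex.comp_f, sheafHomMapLeft_comp, Category.assoc]

/-- `𝓗om•(0, F) = 0`. -/
lemma premap_zero {E E' : CochainComplex X.Modules ℤ} (F : CochainComplex X.Modules ℤ) :
    premap X (0 : E ⟶ E') F = 0 := by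
  refine HomologicalComplex.hom_ext _ _ fun n => HomologicalComplex.mapBifunctor.hom_ext fun q i h => ?_
  change ι X E' F q i n h ≫ _ = ι X E' F q i n h ≫ _
  rw [ι_premap, HomologicalComplex.zero_f, HomologicalComplex.zero_f, comp_zero, sheafHomMapLeft_zero, zero_comp]

/-! ## §3 Degreewise-split short exact `A• → E• → Q•` ⟹ short exact `𝓗om•(Q•, F) → 𝓗om•(E•, F) → 𝓗om•(A•, F)` -/

section Exact

variable (S : ShortComplex (CochainComplex X.Modules ℤ))
  (σ : ∀ m : ℤ, (S.map (HomologicalComplex.eval X.Modules (ComplexShape.up ℤ) m)).Splitting)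
  (F : CochainComplex X.Modules ℤ)

/-- The short complex `𝓗om•(S.X₃, F) → 𝓗om•(S.X₂, F) → 𝓗om•(S.X₁, F)`. -/
def homShortComplex : ShortComplex (CochainComplex X.Modules ℤ) :=
  ShortComplex.mk (premap X S.g F) (premap X S.f F) (by rw [← premap_comp, S.zero, premap_zero])

/-- The degreewise section `S.X₃^i → S.X₂^i` of a degreewise splitting (retyped). -/
def sec (i : ℤ) : S.X₃.X i ⟶ S.X₂.X i := (σ i).s

/-- The degreewise retraction `S.X₂^i → S.X₁^i` of a degreewise splitting (retyped). -/
def ret (i : ℤ) : S.X₂.X i ⟶ S.X₁.X i := (σ i).r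

/-- `s ≫ g = 𝟙` degreewise. -/
lemma sec_g (i : ℤ) : sec X S σ i ≫ S.g.f i = 𝟙 _ := (σ i).s_g

/-- `f ≫ r = 𝟙` degreewise. -/
lemma f_ret (i : ℤ) : S.f.f i ≫ ret X S σ i = 𝟙 _ := (σ i).f_r

/-- `r ≫ f + g ≫ s = 𝟙` degreewise. -/
lemma ret_f_add_g_sec (i : ℤ) : ret X S σ i ≫ S.f.f i + S.g.f i ≫ sec X S σ i = 𝟙 _ := (σ i).id

/-- `ι ≫ desc = component` in the `ι`-language of this file. -/
lemma ι_desc (E : CochainComplex X.Modules ℤ) {A : X.Modules} {n : ℤ}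
    (f : ∀ (q i : ℤ) (_ : q + i = n), sheafHom (E.X (-i)) (F.X q) ⟶ A) (q i : ℤ) (h : q + i = n) :
    ι X E F q i n h ≫ HomologicalComplex.mapBifunctorDesc
      (K₁ := F) (K₂ := dualComplex X E) (F := (sheafHomBifunctor X).flip) (c := ComplexShape.up ℤ) f = f q i h :=
  HomologicalComplex.ι_mapBifunctorDesc _ q i h

/-- Degree-`m` retraction of the Hom short complex: pre-composition with the sections, summand by summand. -/
def rComp (m : ℤ) : (homComplex X S.X₂ F).X m ⟶ (homComplex X S.X₃ F).X m :=
  HomologicalComplex.mapBifunctorDesc (K₁ := F) (K₂ := dualComplex X S.X₂) (F := (sheafHomBifunctor X).flip)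
    (c := ComplexShape.up ℤ) fun q i h => sheafHomMapLeft (sec X S σ (-i)) (F.X q) ≫ ι X S.X₃ F q i m h

/-- Degree-`m` section of the Hom short complex: pre-composition with the retractions, summand by summand. -/
def sComp (m : ℤ) : (homComplex X S.X₁ F).X m ⟶ (homComplex X S.X₂ F).X m :=
  HomologicalComplex.mapBifunctorDesc (K₁ := F) (K₂ := dualComplex X S.X₁) (F := (sheafHomBifunctor X).flip)
    (c := ComplexShape.up ℤ) fun q i h => sheafHomMapLeft (ret X S σ (-i)) (F.X q) ≫ ι X S.X₂ F q i m h

/-- `rComp` on a summand. -/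
lemma ι_rComp (m q i : ℤ) (h : q + i = m) :
    ι X S.X₂ F q i m h ≫ rComp X S σ F m = sheafHomMapLeft (sec X S σ (-i)) (F.X q) ≫ ι X S.X₃ F q i m h :=
  ι_desc X F S.X₂ _ q i h

/-- `sComp` on a summand. -/
lemma ι_sComp (m q i : ℤ) (h : q + i = m) :
    ι X S.X₁ F q i m h ≫ sComp X S σ F m = sheafHomMapLeft (ret X S σ (-i)) (F.X q) ≫ ι X S.X₂ F q i m h :=
  ι_desc X F S.X₁ _ q i h

/-- `𝓗om•(g, F) ≫ rComp = 𝟙` in each degree. -/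
lemma premap_g_rComp (m : ℤ) : (premap X S.g F).f m ≫ rComp X S σ F m = 𝟙 _ := by
  refine HomologicalComplex.mapBifunctor.hom_ext fun q i h => ?_
  change ι X S.X₃ F q i m h ≫ (premap X S.g F).f m ≫ rComp X S σ F m = ι X S.X₃ F q i m h ≫ 𝟙 _
  rw [reassoc_of% (ι_premap X S.g F q i m h), ι_rComp, ← Category.assoc, ← sheafHomMapLeft_comp, sec_g,
    sheafHomMapLeft_id, Category.id_comp, Category.comp_id]

/-- `sComp ≫ 𝓗om•(f, F) = 𝟙` in each degree. -/
lemma sComp_premap_f (m : ℤ) : sComp X S σ F m ≫ (premap X S.f F).f m = 𝟙 _ := by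
  refine HomologicalComplex.mapBifunctor.hom_ext fun q i h => ?_
  change ι X S.X₁ F q i m h ≫ sComp X S σ F m ≫ (premap X S.f F).f m = ι X S.X₁ F q i m h ≫ 𝟙 _
  rw [reassoc_of% (ι_sComp X S σ F m q i h), ι_premap, ← Category.assoc, ← sheafHomMapLeft_comp, f_ret,
    sheafHomMapLeft_id, Category.id_comp, Category.comp_id]

/-- `rComp ≫ 𝓗om•(g, F) + 𝓗om•(f, F) ≫ sComp = 𝟙` in each degree. -/
lemma rComp_add_sComp (m : ℤ) :
    rComp X S σ F m ≫ (premap X S.g F).f m + (premap X S.f F).f m ≫ sComp X S σ F m = 𝟙 _ := by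
  refine HomologicalComplex.mapBifunctor.hom_ext fun q i h => ?_
  change ι X S.X₂ F q i m h ≫ (rComp X S σ F m ≫ (premap X S.g F).f m + (premap X S.f F).f m ≫ sComp X S σ F m) =
    ι X S.X₂ F q i m h ≫ 𝟙 _
  rw [Preadditive.comp_add, reassoc_of% (ι_rComp X S σ F m q i h), ι_premap,
    reassoc_of% (ι_premap X S.f F q i m h), ι_sComp, ← Category.assoc, ← Category.assoc,
    ← sheafHomMapLeft_comp, ← sheafHomMapLeft_comp, ← Preadditive.add_comp, ← sheafHomMapLeft_add, add_comm,
    ret_f_add_g_sec, sheafHomMapLeft_id, Category.id_comp, Category.comp_id]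

/-- Degreewise splitting of the Hom short complex from a degreewise splitting of `S`. -/
def homShortComplexSplitting (m : ℤ) :
    ((homShortComplex X S F).map (HomologicalComplex.eval X.Modules (ComplexShape.up ℤ) m)).Splitting where
  r := rComp X S σ F m
  s := sComp X S σ F m
  f_r := premap_g_rComp X S σ F m
  s_g := sComp_premap_f X S σ F m
  id := rComp_add_sComp X S σ F m

/-- **Short exactness**: for a degreewise-split short exact `A• → E• → Q•`, the sequence
`0 → 𝓗om•(Q•, F•) → 𝓗om•(E•, F•) → 𝓗om•(A•, F•) → 0` is short exact. -/
theorem homShortComplex_shortExact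
    (σ : ∀ m : ℤ, (S.map (HomologicalComplex.eval X.Modules (ComplexShape.up ℤ) m)).Splitting) :
    (homShortComplex X S F).ShortExact :=
  HomologicalComplex.shortExact_of_degreewise_shortExact _ fun m => (homShortComplexSplitting X S σ F m).shortExact

end Exact

/-! ## §4 The induction step for quasi-isomorphisms -/

section Step

variable {E E' F F' : CochainComplex X.Modules ℤ}

/-- Bifunctoriality: pre-composition in `E•` commutes with post-composition in `F•`. -/
lemma premap_comp_map (ψ : E ⟶ E') (φ : F ⟶ F') :
    premap X ψ F ≫ map X E φ = map X E' φ ≫ premap X ψ F' := by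
  refine HomologicalComplex.hom_ext _ _ fun n => HomologicalComplex.mapBifunctor.hom_ext fun q i h => ?_
  change ι X E' F q i n h ≫ _ = ι X E' F q i n h ≫ _
  rw [HomologicalComplex.comp_f, HomologicalComplex.comp_f, reassoc_of% (ι_premap X ψ F q i n h),
    ι_map, reassoc_of% (ι_map X E' φ q i n h), ι_premap, ← Category.assoc, ← Category.assoc,
    sheafHomMapLeft_sheafHomMap]

variable (S : ShortComplex (CochainComplex X.Modules ℤ)) (φ : F ⟶ F')

/-- The morphism of Hom short complexes `𝓗om•(S, F) ⟶ 𝓗om•(S, F')` induced by `φ : F ⟶ F'`. -/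
def homShortComplexMap : homShortComplex X S F ⟶ homShortComplex X S F' where
  τ₁ := map X S.X₃ φ
  τ₂ := map X S.X₂ φ
  τ₃ := map X S.X₁ φ
  comm₁₂ := (premap_comp_map X S.g φ).symm
  comm₂₃ := (premap_comp_map X S.f φ).symm

/-- **Induction step.** For a degreewise-split short exact sequence `S = (A• → E• → Q•)` of complexes of
`𝒪_X`-modules and `φ : F• ⟶ F'•`: if `𝓗om•(Q•, φ)` and `𝓗om•(A•, φ)` are quasi-isomorphisms, so is
`𝓗om•(E•, φ)` (two-out-of-three, middle term, on the Hom short complexes). -/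
theorem quasiIso_map_of_degreewiseSplit
    (σ : ∀ m : ℤ, (S.map (HomologicalComplex.eval X.Modules (ComplexShape.up ℤ) m)).Splitting)
    (h₃ : QuasiIso (map X S.X₃ φ)) (h₁ : QuasiIso (map X S.X₁ φ)) : QuasiIso (map X S.X₂ φ) :=
  Summit.Ventures.HSemireg.quasiIso_τ₂ (homShortComplexMap X S φ)
    (homShortComplex_shortExact X S F σ) (homShortComplex_shortExact X S F' σ) h₃ h₁

end Step

end HomComplex

end Summit.Ventures.HSemireg

end
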